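import Summits.SmoothPoincare4.SmoothPoincare4.Theses.SymplecticOrigami
import Literature.Geometry.Symplectic.PlusOneSpherePair
import Literature.Geometry.Symplectic.PlusOneSphereRigidityProofs

/-!
# Item `McDuffWendlAffinePair` (stmt-SmoothPoincare4-14052) from the PRINTED pair form

The route declaration
`Summit.SmoothPoincare4.SmoothPoincare4.Theses.SymplecticOrigami.McDuffWendlAffinePair`
(= the named fact `Literature.Geometry.Symplectic.mcduffWendl_plusOneSphere_affinePair`, McDuff
1990 Thm. 1.4 + Cor. 1.5 (i) = Wendl 2018 Thm. D (2) in affine complement form; conditional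
closure over that fact in `SymplecticOrigamiMcDuffWendlAffinePair.lean`) is derived here from the
PRINTED pair form `Literature.Geometry.Symplectic.mcduff_plusOneSphere_pairDiffeomorph`
("`(N, b(S))` is diffeomorphic to `(ℂℙ², line)`", `PlusOneSpherePair.lean`): the model pair
`(ℂℙ², {v₂ = 0})` carries the affine pair structure and the structure transports along the
diffeomorphism of pairs — proved in the tree twice, as
`Literature.Geometry.Symplectic.mcduffWendl_plusOneSphere_affinePair_of_pairDiffeo`
(`PlusOneSphereRigidityProofs.lean`, used below) and as the route-side model file
`SymplecticOrigamiMcDuffWendlAffinePairModel.lean`.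

So the item's trust base is ONE printed theorem in its natural form; what remains
(`mcduff_plusOneSphere_pairDiffeomorph` itself: moduli of embedded `J`-holomorphic spheres,
Gromov compactness, positivity of intersections, Wendl's Lefschetz pencil) is formalisation debt
of SIZE XL, not research.
-/

-- the prescribed namespace `Summit.<P>.<Sub>.…` duplicates `SmoothPoincare4` (P = Sub)
set_option linter.dupNamespace false

namespace Summit.SmoothPoincare4.SmoothPoincare4.Theorems

open Literature.Geometry.Symplectic (mcduffWendl_plusOneSphere_affinePair
  mcduff_plusOneSphere_pairDiffeomorph)
open Literature.Geometry.Symplectic.PlusOneSphereRigidity (affinePair_of_pairDiffeo)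

/-- The pair form of McDuff's theorem (`mcduff_plusOneSphere_pairDiffeomorph`: a diffeomorphism
`Φ : N ≃ₘ ℂℙ²` with `Φ(b(S)) = {v₂ = 0}`) implies the affine complement form vendored earlier
(`mcduffWendl_plusOneSphere_affinePair`), by the proved affine pair structure of `(ℂℙ², line)`
transported along `Φ` (`PlusOneSphereRigidity.affinePair_of_pairDiffeo`; cf.
`mcduffWendl_plusOneSphere_affinePair_of_pairDiffeo`, the same with the hypothesis spelled out). -/
theorem affinePairFact_of_pairDiffeomorph (h : mcduff_plusOneSphere_pairDiffeomorph) :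
    mcduffWendl_plusOneSphere_affinePair := by
  intro N _ _ _ _ _ _ _ s S _ _ _ _ _ b hs hc hnd hb hbs hS h2 h1
  obtain ⟨Φ, hΦ⟩ := h N s S b hs hc hnd hb hbs hS h2 h1
  -- `lineAtInfinity` is by definition `{y | ¬ CoordNeZero 2 y}`
  exact affinePair_of_pairDiffeo (Set.range b) Φ hΦ

/-- **Item stmt-SmoothPoincare4-14052 over the printed theorem.** The route declaration
`McDuffWendlAffinePair` (affine complement form of McDuff 1990, Thm. 1.4 + Cor. 1.5 (i) = Wendl
2018, Thm. D (2)) follows from the PAIR FORM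
`Literature.Geometry.Symplectic.mcduff_plusOneSphere_pairDiffeomorph`. CONDITIONAL on that named
fact (McDuff's theorem itself is `J`-holomorphic curve theory, not in the tree). -/
theorem mcDuffWendlAffinePair_of_pairDiffeomorph (h : mcduff_plusOneSphere_pairDiffeomorph) :
    Theses.SymplecticOrigami.McDuffWendlAffinePair :=
  -- the route declaration is VERBATIM the fact `mcduffWendl_plusOneSphere_affinePair`
  -- (`mcDuffWendlAffinePair_iff_affinePairFact`, by `Iff.rfl`), so the proof term is reused
  affinePairFact_of_pairDiffeomorph h

end Summit.SmoothPoincare4.SmoothPoincare4.Theorems
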